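import Summits.CriticalPhenomena.PercolationContinuityZ3.Theorems.PercNearOneGluingNoHeavyLowerTailSahiGridPatternBlockOrT

/-!
# `NoHeavyLowerTail` (crux stmt-CriticalPhenomena-4575), Sahi programme P1: **THE BLOCK-OR VECTOR IS ASSOCIATIVE** — the pointwise identity
# `OR8(OR8(d_S; T, d_T); V, d_V) = OR8(d_S; T ⊕ V, OR8(d_T; V, d_V))`, and its consequence: OR-universality of certificates is closed under block-OR

Support file (Sahi cell, seat `prim-sahi-p1`, generation 35; `--supports stmt-CriticalPhenomena-4575`).  Pure proofs, no definitions, no `sorry`, standard axioms.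
Vocabulary of `…SahiGridPattern{CellForm,SliceForm,BlockOrT}` (`ind`, `nuCount`, `glue`; `ind_glue_blockOr`, `nuCount_blockOr`).

THE MATHEMATICS (seat memo FROM-prim-sahi-p1-gen35, §1).  The block-OR vector of `…BlockOrT` for an outer block `S ⊆ [3]^n` with vector `d_S` and an inner block
`V ⊆ [3]^k` with vector `d_V` has, at the glued point `x = glue ξ q`, the value
  `OR8(x) = s v (2^{n+k} + (2^n s − ν_S)(2^k v − ν_V)) + s(1−v)(2^k d_S − (2^n s − ν_S) ν_V) + (1−s) v (2^k ν_S + (2^n − ν_S) d_V)`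
with `s = 1_S(ξ)`, `v = 1_V(q)`, `ν_S = ν_S(ξ)`, `ν_V = ν_V(q)`, `d_S = d_S(ξ)`, `d_V = d_V(q)` — a polynomial `P(n,k; s,ν_S,d_S; v,ν_V,d_V)` in the point data.
For THREE blocks `S ⊆ [3]^n`, `T ⊆ [3]^m`, `V ⊆ [3]^k` the block-OR set is associative, `(S ⊕ T) ⊕ V = S ⊕ (T ⊕ V)`, and the point data of a block-OR are
`1_{S⊕T} = s + t − st` (`ind_glue_blockOr`) and `ν_{S⊕T} = 2^m ν_S + 2^n ν_T − ν_S ν_T` (`nuCount_blockOr`).  **THEOREM (`blockOr_value_assoc`)**: for indicator values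
`s, t, v ∈ {0,1}` and arbitrary integers `ν_S, ν_T, ν_V, d_S, d_T, d_V`,
  `P(n+m, k; s+t−st, 2^mν_S+2^nν_T−ν_Sν_T, P(n,m; s,ν_S,d_S; t,ν_T,d_T); v,ν_V,d_V) = P(n, m+k; s,ν_S,d_S; t+v−tv, 2^kν_T+2^mν_V−ν_Tν_V, P(m,k; t,ν_T,d_T; v,ν_V,d_V))`,
i.e. building the certificate of `(S⊕T)⊕V` by two outer-first OR steps gives, point for point, the same vector as one OR step of `S` against the inner block `T⊕V`
carrying ITS block-OR vector (eight cases, each a ring identity).  The same holds for the mirrored vector OR8m (`blockOrMirror_value_assoc`).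
CONSEQUENCE (memo §1, stated there; it needs only this identity, `ind_glue_blockOr`, `nuCount_blockOr` and the re-association of glued coordinates).  Call a
certified block `(S, d_S)` OR-UNIVERSAL if for every certified inner block `(V, d_V)` (any dimension; `d_V ≥ 0` vanishing off `V`, conditions (T),(N)) the vector
`OR8(d_S; V, d_V)` is again a certified block vector for `S ⊕ V` (`≥ 0`, (T) — automatic by `diagCert_blockOr_T` —, and (N)).  Then: if `(S, d_S)` and `(T, d_T)` are
OR-universal, so is `(S ⊕ T, OR8(d_S; T, d_T))`: for a certified `(V, d_V)`, `f = OR8(d_T; V, d_V)` is certified (universality of `d_T`), and by the theorem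
`OR8(OR8(d_S;T,d_T); V, d_V) = OR8(d_S; T⊕V, f)`, which is certified (universality of `d_S`).  The literal certificates are OR-universal (`…DiagCertLiteralOr`,
`…DiagCertLiteralTwoOr`, with `…BlockOrMonotone` for the ⪯-larger certificates of `{t ≥ 1}`), so every OR-tree of literals on distinct coordinates carries an
OR-universal recursive certificate; the read-once programme (seat memo gen34 "Conjecture RO") is thereby reduced to the single AND-rule statement "(A^OR): the co-count
product of OR-universal certificates is OR-universal".  Nothing here asserts (A^OR), Conjecture RO, or `PatternPos d` for `d ≥ 4`. [this work]
-/

namespace Summit.CriticalPhenomena.PercolationContinuityZ3.Theorems.SahiGridPattern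

open Finset SahiGrid3
open scoped BigOperators

/-- **Associativity of the block-OR value polynomial** (`OR8(OR8(d_S;T,d_T);V,d_V) = OR8(d_S;T⊕V,OR8(d_T;V,d_V))` pointwise): for indicator values
`s, t, v ∈ {0,1}` and integers `νS, νT, νV, dS, dT, dV`, with `e` the OR8 value of the outer pair `(S,T)` and `f` the OR8 value of the inner pair `(T,V)`. [this work] -/
theorem blockOr_value_assoc (n m k : ℕ) (s t v νS νT νV dS dT dV : ℤ)
    (hs : s = 0 ∨ s = 1) (ht : t = 0 ∨ t = 1) (hv : v = 0 ∨ v = 1) :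
    let e : ℤ := s * t * ((2:ℤ) ^ (n + m) + (2 ^ n * s - νS) * (2 ^ m * t - νT)) + s * (1 - t) * (2 ^ m * dS - (2 ^ n * s - νS) * νT)
        + (1 - s) * t * (2 ^ m * νS + (2 ^ n - νS) * dT)
    let f : ℤ := t * v * ((2:ℤ) ^ (m + k) + (2 ^ m * t - νT) * (2 ^ k * v - νV)) + t * (1 - v) * (2 ^ k * dT - (2 ^ m * t - νT) * νV)
        + (1 - t) * v * (2 ^ k * νT + (2 ^ m - νT) * dV)
    let st : ℤ := s + t - s * t
    let νST : ℤ := 2 ^ m * νS + 2 ^ n * νT - νS * νT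
    let tv : ℤ := t + v - t * v
    let νTV : ℤ := 2 ^ k * νT + 2 ^ m * νV - νT * νV
    st * v * ((2:ℤ) ^ (n + m + k) + (2 ^ (n + m) * st - νST) * (2 ^ k * v - νV)) + st * (1 - v) * (2 ^ k * e - (2 ^ (n + m) * st - νST) * νV)
        + (1 - st) * v * (2 ^ k * νST + (2 ^ (n + m) - νST) * dV)
      = s * tv * ((2:ℤ) ^ (n + (m + k)) + (2 ^ n * s - νS) * (2 ^ (m + k) * tv - νTV)) + s * (1 - tv) * (2 ^ (m + k) * dS - (2 ^ n * s - νS) * νTV)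
        + (1 - s) * tv * (2 ^ (m + k) * νS + (2 ^ n - νS) * f) := by
  intro e f st νST tv νTV
  simp only [e, f, st, νST, tv, νTV]
  rcases hs with rfl | rfl <;> rcases ht with rfl | rfl <;> rcases hv with rfl | rfl <;> ring

/-- **Associativity for the mirrored block-OR value polynomial OR8m** (blocks' roles exchanged in the payment rule: on `S×Vᶜ` the value is
`2^n·ν_V + ν̄_V·d_S`, on `Sᶜ×V` it is `2^n·d_V − h_V·ν_S`): `OR8m(OR8m(d_S;T,d_T);V,d_V) = OR8m(d_S;T⊕V,OR8m(d_T;V,d_V))` pointwise. [this work] -/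
theorem blockOrMirror_value_assoc (n m k : ℕ) (s t v νS νT νV dS dT dV : ℤ)
    (hs : s = 0 ∨ s = 1) (ht : t = 0 ∨ t = 1) (hv : v = 0 ∨ v = 1) :
    let e : ℤ := s * t * ((2:ℤ) ^ (n + m) + (2 ^ n * s - νS) * (2 ^ m * t - νT)) + (1 - s) * t * (2 ^ n * dT - (2 ^ m * t - νT) * νS)
        + s * (1 - t) * (2 ^ n * νT + (2 ^ m - νT) * dS)
    let f : ℤ := t * v * ((2:ℤ) ^ (m + k) + (2 ^ m * t - νT) * (2 ^ k * v - νV)) + (1 - t) * v * (2 ^ m * dV - (2 ^ k * v - νV) * νT)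
        + t * (1 - v) * (2 ^ m * νV + (2 ^ k - νV) * dT)
    let st : ℤ := s + t - s * t
    let νST : ℤ := 2 ^ m * νS + 2 ^ n * νT - νS * νT
    let tv : ℤ := t + v - t * v
    let νTV : ℤ := 2 ^ k * νT + 2 ^ m * νV - νT * νV
    st * v * ((2:ℤ) ^ (n + m + k) + (2 ^ (n + m) * st - νST) * (2 ^ k * v - νV)) + (1 - st) * v * (2 ^ (n + m) * dV - (2 ^ k * v - νV) * νST)
        + st * (1 - v) * (2 ^ (n + m) * νV + (2 ^ k - νV) * e)
      = s * tv * ((2:ℤ) ^ (n + (m + k)) + (2 ^ n * s - νS) * (2 ^ (m + k) * tv - νTV)) + (1 - s) * tv * (2 ^ n * f - (2 ^ (m + k) * tv - νTV) * νS)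
        + s * (1 - tv) * (2 ^ n * νTV + (2 ^ (m + k) - νTV) * dS) := by
  intro e f st νST tv νTV
  simp only [e, f, st, νST, tv, νTV]
  rcases hs with rfl | rfl <;> rcases ht with rfl | rfl <;> rcases hv with rfl | rfl <;> ring

/-- **The cylinder is a left unit up to scaling** (OR8 against the EMPTY inner block of dimension `k` is the cylinder `2^k·d_S`): with `v = 0`, `ν_V = 0`,
`d_V = 0` the OR8 value is `2^k·d_S` on `S` and `0` off `S` (for `d_S` vanishing off `S`).  With `k = 0` this says that OR-universality tested against the
empty inner block `∅ ⊆ [3]^0` returns the certificate `d_S` itself. [this work] -/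
theorem blockOr_value_empty_inner (n k : ℕ) (s νS dS : ℤ) (hs : s = 0 ∨ s = 1) (hdS : s = 0 → dS = 0) :
    s * 0 * ((2:ℤ) ^ (n + k) + (2 ^ n * s - νS) * (2 ^ k * 0 - 0)) + s * (1 - 0) * (2 ^ k * dS - (2 ^ n * s - νS) * 0)
        + (1 - s) * 0 * (2 ^ k * νS + (2 ^ n - νS) * 0) = 2 ^ k * dS := by
  rcases hs with rfl | rfl
  · rw [hdS rfl]; ring
  · ring

/-- **Instantiation at glued points** (the data of a block-OR as needed by `blockOr_value_assoc`): for `A = S ⊕ T` and the glued point `glue ξ η`,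
`1_A = s + t − st` and `ν_A = 2^m ν_S + 2^n ν_T − ν_S ν_T`. (Re-export of `ind_glue_blockOr` / `nuCount_blockOr` in the polynomial's variables.) [this work] -/
theorem blockOr_point_data {n m : ℕ} {S : Finset (Pd n)} {T : Finset (Pd m)} {A : Finset (Pd (n + m))}
    (hA : ∀ ξ z, glue ξ z ∈ A ↔ (ξ ∈ S ∨ z ∈ T)) (ξ : Pd n) (η : Pd m) :
    ind A (glue ξ η) = ind S ξ + ind T η - ind S ξ * ind T η ∧
      (nuCount A (glue ξ η) : ℤ) = 2 ^ m * (nuCount S ξ : ℤ) + 2 ^ n * (nuCount T η : ℤ) - (nuCount S ξ : ℤ) * (nuCount T η : ℤ) :=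
  ⟨ind_glue_blockOr hA ξ η, nuCount_blockOr hA ξ η⟩

end Summit.CriticalPhenomena.PercolationContinuityZ3.Theorems.SahiGridPattern
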